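import Literature.NumberTheory.Automorphic.ArchEndoscopicCartanAtlasRegular     -- ★ PART 1∕1b: `endoTorus`, `endoBlock`, `endoCircle`, `hypBlockGL`, Cayley frame
import Literature.NumberTheory.Automorphic.ArchInnerFormCartanAtlasCentralizer   -- ★ (CENT-G): `eq_diagonal_of_commute_diagonal` (+ ★ `eq_diagonal_of_commute_circleDiagonal`)
import Literature.NumberTheory.Automorphic.ArchCartanCoordinates                 -- ★ (COORD): `ArchCartan.RegS`, `mem_regS_iff`
import HarnessLib

/-!
# The centraliser of a regular chart point of `H_∞` is the chart torus ((T-ATLAS) PART 1c = (CENT-H); Rogawski 1990 §3.1, §3.6, §8.2)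

Topic `NumberTheory/Automorphic`; namespace `Literature.NumberTheory.Automorphic.UnitaryGroup`.  THEOREMS ONLY (no `def`, no instance, no notation, no axiom, no
named fact, no `sorry`).  Cell `pub/hodgecm-mathlib`, crux H413 (`stmt-HodgeConjecture-24833`), F0∕P3c line LH3, DIRECT ROAD of `stub_N9`; seat LH3-p03 (g2); organ
(CENT-H) (PACK-SPEC v1 §1: `chartTorusH S = Z(endoTorus S c)` at regular `c` — the identity through which (T-MEAS)'s chart Haar measure `chartHaarH S` (LH2-p04 (g3)) and
(CUR)'s centraliser measures `t_H(γ_H)` (LH3-p02 (g2)) are compared).  Count-neutral.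

THE MATHEMATICS.  `H_∞ = U(Φ₂)(L⁺ ⊗ ℝ) × U(Φ₁)(L⁺ ⊗ ℝ)`; the chart `endoTorus S c` (★ PART 1) has `U(Φ₂)_w`-block `diag(e^{x_w+iθ_w}, e^{−x_w+iθ_w})` at `w ∈ S` and the Cayley
block `P·diag(e^{ic_w0}, e^{ic_w2})·P⁻¹` at `w ∉ S`, and `U(Φ₁)_w`-entry `e^{ic_w1}`.  For `c ∈ RegS S` ((COORD): `x_w ≠ 0` on `S`, `e^{ic_w0} ≠ e^{ic_w2}` off `S` — `H`-regularity
suffices, the `U(Φ₁)` factor being abelian) let `g = (g₂, g₁) ∈ H_∞` commute with `endoTorus S c`.  Place by place (★ `archPiEquivCM`): at `w ∈ S`, `g₂,w` commutes with a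
diagonal matrix with distinct entries, so is diagonal `diag(p, q)` (★ `eq_diagonal_of_commute_diagonal`), and `Φ₂`-unitarity is `p̄ q = 1` (★ `diag_mem_unitary_antidiag_iff`), so
`g₂,w = diag(e^{x′+iθ′}, e^{−x′+iθ′})` with `x′ = log ‖p‖`, `θ′ = arg p`; at `w ∉ S`, `P⁻¹ g₂,w P` commutes with `diag(z₀, z₂)`, `z₀ ≠ z₂`, so is diagonal (★
`eq_diagonal_of_commute_circleDiagonal`) and lies in `U(P̄ᵀΦ₂P) = U(diag(2, −2))` (★ `conj_mem_unitaryGroupOfForm_iff`, ★ `formCongr_cayleyTwo`), so has unit entries; and every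
element of `U(Φ₁)_w = U(1)` is `e^{iφ′}`.  Hence **`g = endoTorus S c′`** (`exists_eq_endoTorus_of_commute`) and, the chart being commutative (`endoTorus_mul_comm`),
**`g ∈ Z(endoTorus S c) ↔ ∃ c′, g = endoTorus S c′`** (`mem_centralizer_endoTorus_iff`): the chart torus is the full centraliser, in whichever spelling.
* §1 local: `norm_eq_one_of_mem_unitaryGroupOfForm_diagonal`, `exists_eq_circleDiagonal_of_mem_unitaryGroupOfForm_diagonal`, `exists_eq_circleDiagonal_one`,
  `exists_eq_hypBlockGL_of_commute`, `exists_eq_cayley_conj_circleDiagonal_of_commute`;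
* §2 global: `endoTorus_mul_comm`, **`exists_eq_endoTorus_of_commute`**, **`mem_centralizer_endoTorus_iff`**, `centralizer_endoTorus_eq_centralizer`, `endoTorus_mem_centralizer`.
HONEST LABEL: HC_CM is proved only modulo the 7 printed citations (2 remaining: hLiu418 = `stmt-HodgeConjecture-24832`, h413 = `stmt-HodgeConjecture-24833`) until rung 0
closes; centraliser bookkeeping on the chart, count-neutral (+0∕+0).

## References
* [Rogawski1990] J. D. Rogawski, *Automorphic Representations of Unitary Groups in Three Variables*, Ann. of Math. Stud. 123 (1990), §3.1 p. 19 (regular elements,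
  Cartan subgroups), §3.6 p. 31, §8.2 p. 122 (the Cayley frame of the compact torus of `U(1,1)`).
* [BrockerTomDieck1985] T. Bröcker, T. tom Dieck, *Representations of Compact Lie Groups* (1985), IV (2.3)(i).
-/

set_option autoImplicit false

noncomputable section

open NumberField NumberField.InfinitePlace NumberField.mixedEmbedding Matrix Complex
open scoped MatrixGroups Matrix ComplexConjugate Real Classical

namespace Literature.NumberTheory.Automorphic.UnitaryGroup

open Literature.NumberTheory.Rogawski1990

/-! ## §1 Local blocks -/

section Local

/-- **A diagonal element of `U(diag e)(ℂ)` (`e_i ≠ 0`) has unit entries**: `ḡ_ii e_i g_ii = e_i`. [cite: Rogawski1990, §3.1 p. 19] -/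
theorem norm_eq_one_of_mem_unitaryGroupOfForm_diagonal {N : ℕ} {e : Fin N → ℂ} (he : ∀ i, e i ≠ 0) {g : GL (Fin N) ℂ}
    (hg : g ∈ unitaryGroupOfForm (starRingEnd ℂ) (Matrix.diagonal e))
    (hd : (g : Matrix (Fin N) (Fin N) ℂ) = Matrix.diagonal fun i => (g : Matrix (Fin N) (Fin N) ℂ) i i) (i : Fin N) :
    ‖(g : Matrix (Fin N) (Fin N) ℂ) i i‖ = 1 := by
  rw [mem_unitaryGroupOfForm_iff, transpose_map_starRingEnd_complex] at hg
  have h := congrFun (congrFun hg i) i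
  rw [hd, Matrix.diagonal_conjTranspose, Matrix.diagonal_mul_diagonal, Matrix.diagonal_mul_diagonal, Matrix.diagonal_apply_eq,
    Matrix.diagonal_apply_eq] at h
  have h2 : (starRingEnd ℂ) ((g : Matrix (Fin N) (Fin N) ℂ) i i) * (g : Matrix (Fin N) (Fin N) ℂ) i i = 1 := by
    have h' : ((starRingEnd ℂ) ((g : Matrix (Fin N) (Fin N) ℂ) i i) * (g : Matrix (Fin N) (Fin N) ℂ) i i - 1) * e i = 0 := by
      have hs : (star fun j => (g : Matrix (Fin N) (Fin N) ℂ) j j) i = (starRingEnd ℂ) ((g : Matrix (Fin N) (Fin N) ℂ) i i) := rfl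
      rw [hs] at h
      linear_combination h
    rcases mul_eq_zero.1 h' with h1 | h1
    · exact sub_eq_zero.1 h1
    · exact absurd h1 (he i)
  have h3 : ((‖(g : Matrix (Fin N) (Fin N) ℂ) i i‖ : ℂ)) ^ 2 = 1 := by rw [← Complex.conj_mul', h2]
  have h4 : ‖(g : Matrix (Fin N) (Fin N) ℂ) i i‖ ^ 2 = 1 := by exact_mod_cast h3
  exact (pow_eq_one_iff_of_nonneg (norm_nonneg _) two_ne_zero).1 h4

/-- **A diagonal element of `U(diag e)(ℂ)` (`e_i ≠ 0`) is `circleDiagonal z`**, `z_i = g_ii ∈ S¹`. [cite: Rogawski1990, §3.1 p. 19] -/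
theorem exists_eq_circleDiagonal_of_mem_unitaryGroupOfForm_diagonal {N : ℕ} {e : Fin N → ℂ} (he : ∀ i, e i ≠ 0) {g : GL (Fin N) ℂ}
    (hg : g ∈ unitaryGroupOfForm (starRingEnd ℂ) (Matrix.diagonal e))
    (hd : (g : Matrix (Fin N) (Fin N) ℂ) = Matrix.diagonal fun i => (g : Matrix (Fin N) (Fin N) ℂ) i i) :
    ∃ z : Fin N → Circle, g = circleDiagonal N z := by
  refine ⟨fun i => ⟨(g : Matrix (Fin N) (Fin N) ℂ) i i, mem_sphere_zero_iff_norm.mpr (norm_eq_one_of_mem_unitaryGroupOfForm_diagonal he hg hd i)⟩,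
    Matrix.GeneralLinearGroup.ext fun i j => ?_⟩
  rw [coe_circleDiagonal]
  conv_lhs => rw [hd]

variable (L : Type) [Field L] (w : {w : InfinitePlace L // IsComplex w})

/-- **Every element of `U(Φ₁)_w = U(1)` is `e^{iφ}`** (`= circleDiagonal 1 (e^{iφ})`, `φ = arg`). [cite: Rogawski1990, §4.9 p. 54] -/
theorem exists_eq_circleDiagonal_one (g : ↥(archLocal L 1 (Matrix.of fun i j : Fin 1 => if i.val + j.val + 1 = 1 then (1 : L) else 0) w)) :
    ∃ φ : ℝ, (g : GL (Fin 1) ℂ) = circleDiagonal 1 ![Circle.exp φ] := by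
  have hg : (g : GL (Fin 1) ℂ) ∈ unitaryGroupOfForm (starRingEnd ℂ) (Matrix.diagonal fun _ : Fin 1 => (1 : ℂ)) := by
    have h := g.2
    change (g : GL (Fin 1) ℂ) ∈ unitaryGroupOfForm (starRingEnd ℂ) _ at h
    rwa [Literature.NumberTheory.Automorphic.UnitaryGroup.antidiagOne_map] at h
  have hd : ((g : GL (Fin 1) ℂ) : Matrix (Fin 1) (Fin 1) ℂ) = Matrix.diagonal fun i => ((g : GL (Fin 1) ℂ) : Matrix (Fin 1) (Fin 1) ℂ) i i := by
    ext i j; fin_cases i; fin_cases j; rfl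
  obtain ⟨z, hz⟩ := exists_eq_circleDiagonal_of_mem_unitaryGroupOfForm_diagonal (fun _ => one_ne_zero) hg hd
  refine ⟨Complex.arg (z 0 : ℂ), ?_⟩
  rw [hz]
  congr 1
  funext i
  fin_cases i
  exact (Circle.exp_arg (z 0)).symm

/-- **Split block**: an element of `U(Φ₂)_w` commuting with `diag(e^{x+iθ}, e^{−x+iθ})`, `x ≠ 0`, IS some `diag(e^{x′+iθ′}, e^{−x′+iθ′})` (diagonal by distinct
eigenvalues; `p̄ q = 1` by ★ `diag_mem_unitary_antidiag_iff`; `x′ = log ‖p‖`, `θ′ = arg p`). [cite: Rogawski1990, §3.1 p. 19; §3.6 p. 31] -/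
theorem exists_eq_hypBlockGL_of_commute {x : ℝ} (hx : x ≠ 0) (θ : ℝ)
    (g : ↥(archLocal L 2 (Matrix.of fun i j : Fin 2 => if i.val + j.val + 1 = 2 then (1 : L) else 0) w))
    (hg : (g : GL (Fin 2) ℂ) * hypBlockGL x θ = hypBlockGL x θ * g) :
    ∃ x' θ' : ℝ, (g : GL (Fin 2) ℂ) = hypBlockGL x' θ' := by
  -- the block is a diagonal matrix with distinct entries
  have hdiag : ((hypBlockGL x θ : GL (Fin 2) ℂ) : Matrix (Fin 2) (Fin 2) ℂ) =
      Matrix.diagonal ![Complex.exp ((x : ℂ) + (θ : ℂ) * I), Complex.exp (-(x : ℂ) + (θ : ℂ) * I)] := by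
    rw [coe_hypBlockGL]; ext i j; fin_cases i <;> fin_cases j <;> simp
  have hinj : Function.Injective (![Complex.exp ((x : ℂ) + (θ : ℂ) * I), Complex.exp (-(x : ℂ) + (θ : ℂ) * I)] : Fin 2 → ℂ) := by
    have hne : Complex.exp ((x : ℂ) + (θ : ℂ) * I) ≠ Complex.exp (-(x : ℂ) + (θ : ℂ) * I) := by
      intro h
      have hn := congrArg (fun z : ℂ => ‖z‖) h
      simp only [Complex.norm_exp] at hn
      simp at hn
      exact hx (by linarith)
    intro i j h
    fin_cases i <;> fin_cases j
    · rfl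
    · exact absurd (by simpa using h) hne
    · exact absurd (by simpa using h.symm) hne
    · rfl
  have hGd : ((g : GL (Fin 2) ℂ) : Matrix (Fin 2) (Fin 2) ℂ) = Matrix.diagonal fun i => ((g : GL (Fin 2) ℂ) : Matrix (Fin 2) (Fin 2) ℂ) i i := by
    refine eq_diagonal_of_commute_diagonal hinj ?_
    have h := congrArg (fun u : GL (Fin 2) ℂ => (u : Matrix (Fin 2) (Fin 2) ℂ)) hg
    simpa only [Units.val_mul, hdiag] using h
  -- unitarity: `p̄ q = 1`
  have hU := (mem_archLocal_iff L 2 _ w (g : GL (Fin 2) ℂ)).1 g.2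
  rw [Literature.NumberTheory.Rogawski1990.antidiagOne_map] at hU
  generalize hG : ((g : GL (Fin 2) ℂ) : Matrix (Fin 2) (Fin 2) ℂ) = G at hGd hU
  have hG2 : G = !![G 0 0, 0; 0, G 1 1] := by
    rw [hGd]; ext i j; fin_cases i <;> fin_cases j <;> simp
  rw [hG2] at hU
  have hpq : conj (G 0 0) * G 1 1 = 1 := (diag_mem_unitary_antidiag_iff (G 0 0) (G 1 1)).1 hU
  have hp : G 0 0 ≠ 0 := by
    intro h0; rw [h0, map_zero, zero_mul] at hpq; exact zero_ne_one hpq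
  set x' : ℝ := Real.log ‖G 0 0‖ with hx'
  set θ' : ℝ := Complex.arg (G 0 0) with hθ'
  refine ⟨x', θ', Matrix.GeneralLinearGroup.ext fun i j => ?_⟩
  have e0 : Complex.exp ((x' : ℂ) + (θ' : ℂ) * I) = G 0 0 := by
    rw [Complex.exp_add, ← Complex.ofReal_exp, Real.exp_log (norm_pos_iff.2 hp)]
    exact Complex.norm_mul_exp_arg_mul_I (G 0 0)
  have e1 : Complex.exp (-(x' : ℂ) + (θ' : ℂ) * I) = G 1 1 := by
    have hstar : conj (G 0 0) = Complex.exp ((x' : ℂ) - (θ' : ℂ) * I) := by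
      rw [← e0, ← Complex.exp_conj, map_add, map_mul, Complex.conj_ofReal, Complex.conj_ofReal, Complex.conj_I]
      ring_nf
    have h11 : G 1 1 = (conj (G 0 0))⁻¹ := eq_inv_of_mul_eq_one_right hpq
    rw [h11, hstar, ← Complex.exp_neg]
    congr 1
    ring
  rw [hG, coe_hypBlockGL, hG2]
  fin_cases i <;> fin_cases j
  · simpa using e0.symm
  · simp
  · simp
  · simpa using e1.symm

/-- **Compact block**: an element of `U(Φ₂)_w` commuting with the Cayley block `P·diag(z₀, z₁)·P⁻¹`, `z₀ ≠ z₁`, IS some `P·diag(z′)·P⁻¹` (`P⁻¹ g P` is diagonal by ★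
`eq_diagonal_of_commute_circleDiagonal` and lies in `U(diag(2, −2))` by ★ `conj_mem_unitaryGroupOfForm_iff` + ★ `formCongr_cayleyTwo`, so has unit entries).
[cite: Rogawski1990, §8.2 p. 122; §3.1 p. 19] -/
theorem exists_eq_cayley_conj_circleDiagonal_of_commute {z : Fin 2 → Circle} (hz : z 0 ≠ z 1)
    (g : ↥(archLocal L 2 (Matrix.of fun i j : Fin 2 => if i.val + j.val + 1 = 2 then (1 : L) else 0) w))
    (hg : (g : GL (Fin 2) ℂ) * (Matrix.GeneralLinearGroup.mkOfDetNeZero !![(1 : ℂ), 1; 1, -1] det_cayleyTwo_ne_zero * circleDiagonal 2 z *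
        (Matrix.GeneralLinearGroup.mkOfDetNeZero !![(1 : ℂ), 1; 1, -1] det_cayleyTwo_ne_zero)⁻¹) =
      Matrix.GeneralLinearGroup.mkOfDetNeZero !![(1 : ℂ), 1; 1, -1] det_cayleyTwo_ne_zero * circleDiagonal 2 z *
        (Matrix.GeneralLinearGroup.mkOfDetNeZero !![(1 : ℂ), 1; 1, -1] det_cayleyTwo_ne_zero)⁻¹ * g) :
    ∃ z' : Fin 2 → Circle, (g : GL (Fin 2) ℂ) = Matrix.GeneralLinearGroup.mkOfDetNeZero !![(1 : ℂ), 1; 1, -1] det_cayleyTwo_ne_zero * circleDiagonal 2 z' *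
        (Matrix.GeneralLinearGroup.mkOfDetNeZero !![(1 : ℂ), 1; 1, -1] det_cayleyTwo_ne_zero)⁻¹ := by
  generalize hP : Matrix.GeneralLinearGroup.mkOfDetNeZero !![(1 : ℂ), 1; 1, -1] det_cayleyTwo_ne_zero = P at hg ⊢
  -- `h = P⁻¹ g P` commutes with `diag(z)`
  have hcomm : (P⁻¹ * (g : GL (Fin 2) ℂ) * P) * circleDiagonal 2 z = circleDiagonal 2 z * (P⁻¹ * (g : GL (Fin 2) ℂ) * P) := by
    have h1 : P⁻¹ * ((g : GL (Fin 2) ℂ) * (P * circleDiagonal 2 z * P⁻¹)) * P = P⁻¹ * (P * circleDiagonal 2 z * P⁻¹ * (g : GL (Fin 2) ℂ)) * P := by rw [hg]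
    have e1 : P⁻¹ * ((g : GL (Fin 2) ℂ) * (P * circleDiagonal 2 z * P⁻¹)) * P = (P⁻¹ * (g : GL (Fin 2) ℂ) * P) * circleDiagonal 2 z := by
      simp only [mul_assoc, inv_mul_cancel, mul_one]
    have e2 : P⁻¹ * (P * circleDiagonal 2 z * P⁻¹ * (g : GL (Fin 2) ℂ)) * P = circleDiagonal 2 z * (P⁻¹ * (g : GL (Fin 2) ℂ) * P) := by
      simp only [mul_assoc, inv_mul_cancel_left]
    rw [e1, e2] at h1
    exact h1
  have hzinj : Function.Injective z := by
    intro i j h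
    fin_cases i <;> fin_cases j
    · rfl
    · exact absurd h hz
    · exact absurd h.symm hz
    · rfl
  have hHd : ((P⁻¹ * (g : GL (Fin 2) ℂ) * P : GL (Fin 2) ℂ) : Matrix (Fin 2) (Fin 2) ℂ) =
      Matrix.diagonal fun i => ((P⁻¹ * (g : GL (Fin 2) ℂ) * P : GL (Fin 2) ℂ) : Matrix (Fin 2) (Fin 2) ℂ) i i := by
    refine eq_diagonal_of_commute_circleDiagonal 2 hzinj ?_
    have h := congrArg (fun u : GL (Fin 2) ℂ => (u : Matrix (Fin 2) (Fin 2) ℂ)) hcomm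
    simpa only [Units.val_mul] using h
  -- `h ∈ U(diag(2, −2))`
  have hmem : P⁻¹ * (g : GL (Fin 2) ℂ) * P ∈ unitaryGroupOfForm (starRingEnd ℂ) (Matrix.diagonal ![(2 : ℂ), -2]) := by
    have h1 : P * (P⁻¹ * (g : GL (Fin 2) ℂ) * P) * P⁻¹ = (g : GL (Fin 2) ℂ) := by
      simp only [mul_assoc, mul_inv_cancel, mul_one, mul_inv_cancel_left]
    have h2 : P * (P⁻¹ * (g : GL (Fin 2) ℂ) * P) * P⁻¹ ∈ unitaryGroupOfForm (starRingEnd ℂ)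
        ((Matrix.of fun i j : Fin 2 => if i.val + j.val + 1 = 2 then (1 : L) else 0).map w.1.embedding) := by
      rw [h1]; exact g.2
    have h3 := (conj_mem_unitaryGroupOfForm_iff (starRingEnd ℂ) P _ _).1 h2
    rwa [← hP, formCongr_cayleyTwo, hP] at h3
  obtain ⟨z', hz'⟩ := exists_eq_circleDiagonal_of_mem_unitaryGroupOfForm_diagonal
    (e := ![(2 : ℂ), -2]) (fun i => by fin_cases i <;> simp) hmem hHd
  refine ⟨z', ?_⟩
  rw [← hz']
  simp only [mul_assoc, mul_inv_cancel, mul_one, mul_inv_cancel_left]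

end Local

/-! ## §2 The chart `endoTorus S c` of `H_∞`: commutativity and the centraliser of a regular point -/

section Coe

variable (L : Type) [Field L] (S : Finset {w : InfinitePlace L // IsComplex w})

/-- At a split place the `U(Φ₂)_w`-component of the chart, as a `GL₂(ℂ)` element, is `hypBlockGL x_w θ_w`. [cite: Rogawski1990, §3.6 p. 31] -/
theorem coe_endoBlock_eq_hypBlockGL_of_mem (c : {w : InfinitePlace L // IsComplex w} → Fin 3 → ℝ) {w : {w : InfinitePlace L // IsComplex w}} (hw : w ∈ S) :
    (endoBlock L S c w : GL (Fin 2) ℂ) = hypBlockGL (c w 0) (c w 2) := by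
  unfold endoBlock
  rw [if_pos hw]

/-- At a compact place the `U(Φ₂)_w`-component of the chart, as a `GL₂(ℂ)` element, is the Cayley block `P·diag(e^{ic_w0}, e^{ic_w2})·P⁻¹`. [cite: Rogawski1990, §8.2 p. 122] -/
theorem coe_endoBlock_eq_cayley_of_not_mem (c : {w : InfinitePlace L // IsComplex w} → Fin 3 → ℝ) {w : {w : InfinitePlace L // IsComplex w}} (hw : w ∉ S) :
    (endoBlock L S c w : GL (Fin 2) ℂ) =
      Matrix.GeneralLinearGroup.mkOfDetNeZero !![(1 : ℂ), 1; 1, -1] det_cayleyTwo_ne_zero * circleDiagonal 2 ![Circle.exp (c w 0), Circle.exp (c w 2)] * (Matrix.GeneralLinearGroup.mkOfDetNeZero !![(1 : ℂ), 1; 1, -1] det_cayleyTwo_ne_zero)⁻¹ := by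
  unfold endoBlock
  rw [if_neg hw]

/-- The `U(Φ₁)_w`-component of the chart, as a `GL₁(ℂ)` element, is `circleDiagonal 1 (e^{ic_w1})`. [cite: Rogawski1990, §4.9 p. 54] -/
theorem coe_endoCircle_eq (c : {w : InfinitePlace L // IsComplex w} → Fin 3 → ℝ) (w : {w : InfinitePlace L // IsComplex w}) :
    (endoCircle L c w : GL (Fin 1) ℂ) = circleDiagonal 1 ![Circle.exp (c w 1)] := rfl

end Coe

section Global

variable (L : Type) [Field L] [NumberField L] [IsCMField L] (S : Finset {w : InfinitePlace L // IsComplex w})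

/-- **The chart is commutative**: `endoTorus S c · endoTorus S c′ = endoTorus S c′ · endoTorus S c` (diagonal ∕ Cayley-conjugate-diagonal ∕ scalar blocks commute place by place).
[cite: Rogawski1990, §3.6 p. 31] -/
theorem endoTorus_mul_comm (c c' : {w : InfinitePlace L // IsComplex w} → Fin 3 → ℝ) : endoTorus L S c * endoTorus L S c' = endoTorus L S c' * endoTorus L S c := by
  refine Prod.ext ?_ ?_
  · apply (archPiEquivCM 2 L (Matrix.of fun i j : Fin 2 => if i.val + j.val + 1 = 2 then (1 : L) else 0)).injective
    rw [Prod.fst_mul, Prod.fst_mul, map_mul, map_mul]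
    funext w
    rw [Pi.mul_apply, Pi.mul_apply, archPiEquivCM_endoTorus_fst, archPiEquivCM_endoTorus_fst]
    apply Subtype.ext
    rw [Subgroup.coe_mul, Subgroup.coe_mul]
    by_cases hw : w ∈ S
    · rw [coe_endoBlock_eq_hypBlockGL_of_mem L S c hw, coe_endoBlock_eq_hypBlockGL_of_mem L S c' hw]
      refine Matrix.GeneralLinearGroup.ext fun i j => ?_
      rw [Units.val_mul, Units.val_mul, coe_hypBlockGL, coe_hypBlockGL]
      fin_cases i <;> fin_cases j <;> simp [Matrix.mul_apply, Fin.sum_univ_two] <;> ring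
    · rw [coe_endoBlock_eq_cayley_of_not_mem L S c hw, coe_endoBlock_eq_cayley_of_not_mem L S c' hw]
      have hDD : circleDiagonal 2 ![Circle.exp (c w 0), Circle.exp (c w 2)] * circleDiagonal 2 ![Circle.exp (c' w 0), Circle.exp (c' w 2)] =
          circleDiagonal 2 ![Circle.exp (c' w 0), Circle.exp (c' w 2)] * circleDiagonal 2 ![Circle.exp (c w 0), Circle.exp (c w 2)] := by
        rw [← map_mul, ← map_mul, mul_comm]
      simp only [mul_assoc, inv_mul_cancel_left]
      rw [← mul_assoc (circleDiagonal 2 _) (circleDiagonal 2 _), hDD, mul_assoc]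
  · apply (archPiEquivCM 1 L (Matrix.of fun i j : Fin 1 => if i.val + j.val + 1 = 1 then (1 : L) else 0)).injective
    rw [Prod.snd_mul, Prod.snd_mul, map_mul, map_mul]
    funext w
    rw [Pi.mul_apply, Pi.mul_apply, archPiEquivCM_endoTorus_snd, archPiEquivCM_endoTorus_snd]
    apply Subtype.ext
    rw [Subgroup.coe_mul, Subgroup.coe_mul, coe_endoCircle_eq, coe_endoCircle_eq, ← map_mul, ← map_mul, mul_comm]

/-- **`Z_{H_∞}(endoTorus S c) ⊆` chart torus at an `H`-regular chart point**: every `g ∈ H_∞` commuting with `endoTorus S c`, `c ∈ RegS S`, is `endoTorus S c′` for some `c′`.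
[cite: Rogawski1990, §3.1 p. 19; §3.6 p. 31; §8.2 p. 122] -/
theorem exists_eq_endoTorus_of_commute {c : {w : InfinitePlace L // IsComplex w} → Fin 3 → ℝ} (hc : c ∈ ArchCartan.RegS S)
    (g : (↥(arch (↥(maximalRealSubfield L)) L (IsCMField.complexConj L) 2 (Matrix.of fun i j : Fin 2 => if i.val + j.val + 1 = 2 then (1 : L) else 0)) × ↥(arch (↥(maximalRealSubfield L)) L (IsCMField.complexConj L) 1 (Matrix.of fun i j : Fin 1 => if i.val + j.val + 1 = 1 then (1 : L) else 0))))
    (hg : g * endoTorus L S c = endoTorus L S c * g) :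
    ∃ c' : {w : InfinitePlace L // IsComplex w} → Fin 3 → ℝ, g = endoTorus L S c' := by
  rw [ArchCartan.mem_regS_iff] at hc
  have hg1 : g.1 * (endoTorus L S c).1 = (endoTorus L S c).1 * g.1 := congrArg Prod.fst hg
  have key : ∀ w : {w : InfinitePlace L // IsComplex w}, ∃ cw' : Fin 3 → ℝ,
      ((archPiEquivCM 2 L (Matrix.of fun i j : Fin 2 => if i.val + j.val + 1 = 2 then (1 : L) else 0) g.1 w : ↥(archLocal L 2 (Matrix.of fun i j : Fin 2 => if i.val + j.val + 1 = 2 then (1 : L) else 0) w)) : GL (Fin 2) ℂ) =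
          (endoBlock L S (fun _ => cw') w : GL (Fin 2) ℂ) ∧
        ((archPiEquivCM 1 L (Matrix.of fun i j : Fin 1 => if i.val + j.val + 1 = 1 then (1 : L) else 0) g.2 w : ↥(archLocal L 1 (Matrix.of fun i j : Fin 1 => if i.val + j.val + 1 = 1 then (1 : L) else 0) w)) : GL (Fin 1) ℂ) =
          (endoCircle L (fun _ => cw') w : GL (Fin 1) ℂ) := by
    intro w
    obtain ⟨φ, hφ⟩ := exists_eq_circleDiagonal_one L w (archPiEquivCM 1 L (Matrix.of fun i j : Fin 1 => if i.val + j.val + 1 = 1 then (1 : L) else 0) g.2 w)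
    have hgw := congrArg (fun x : ↥(arch (↥(maximalRealSubfield L)) L (IsCMField.complexConj L) 2 (Matrix.of fun i j : Fin 2 => if i.val + j.val + 1 = 2 then (1 : L) else 0)) =>
      ((archPiEquivCM 2 L (Matrix.of fun i j : Fin 2 => if i.val + j.val + 1 = 2 then (1 : L) else 0) x w : ↥(archLocal L 2 (Matrix.of fun i j : Fin 2 => if i.val + j.val + 1 = 2 then (1 : L) else 0) w)) : GL (Fin 2) ℂ)) hg1
    simp only [map_mul, Pi.mul_apply, Subgroup.coe_mul, archPiEquivCM_endoTorus_fst] at hgw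
    by_cases hw : w ∈ S
    · rw [coe_endoBlock_eq_hypBlockGL_of_mem L S c hw] at hgw
      obtain ⟨x', θ', h⟩ := exists_eq_hypBlockGL_of_commute L w (hc.2 w hw) (c w 2) _ hgw
      refine ⟨![x', φ, θ'], ?_, ?_⟩
      · rw [h, coe_endoBlock_eq_hypBlockGL_of_mem L S _ hw]
        rfl
      · rw [hφ, coe_endoCircle_eq]
        rfl
    · rw [coe_endoBlock_eq_cayley_of_not_mem L S c hw] at hgw
      have hz : (![Circle.exp (c w 0), Circle.exp (c w 2)] : Fin 2 → Circle) 0 ≠ (![Circle.exp (c w 0), Circle.exp (c w 2)] : Fin 2 → Circle) 1 := by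
        simpa using hc.1 w hw
      obtain ⟨z', h⟩ := exists_eq_cayley_conj_circleDiagonal_of_commute L w hz _ hgw
      refine ⟨![Complex.arg (z' 0 : ℂ), φ, Complex.arg (z' 1 : ℂ)], ?_, ?_⟩
      · rw [h, coe_endoBlock_eq_cayley_of_not_mem L S _ hw]
        have hz' : (![Circle.exp ((fun _ : {w : InfinitePlace L // IsComplex w} => (![Complex.arg (z' 0 : ℂ), φ, Complex.arg (z' 1 : ℂ)] : Fin 3 → ℝ)) w 0),
            Circle.exp ((fun _ : {w : InfinitePlace L // IsComplex w} => (![Complex.arg (z' 0 : ℂ), φ, Complex.arg (z' 1 : ℂ)] : Fin 3 → ℝ)) w 2)] : Fin 2 → Circle) = z' := by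
          funext i
          fin_cases i
          · simp [Circle.exp_arg]
          · simp [Circle.exp_arg]
        rw [hz']
      · rw [hφ, coe_endoCircle_eq]
        rfl
  choose c' hc' using key
  refine ⟨c', Prod.ext ?_ ?_⟩
  · apply (archPiEquivCM 2 L (Matrix.of fun i j : Fin 2 => if i.val + j.val + 1 = 2 then (1 : L) else 0)).injective
    rw [show (endoTorus L S c').1 = (archPiEquivCM 2 L (Matrix.of fun i j : Fin 2 => if i.val + j.val + 1 = 2 then (1 : L) else 0)).symm (endoBlock L S c') from rfl, ContinuousMulEquiv.apply_symm_apply]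
    funext w
    apply Subtype.ext
    rw [(hc' w).1]
    by_cases hw : w ∈ S
    · rw [coe_endoBlock_eq_hypBlockGL_of_mem L S _ hw, coe_endoBlock_eq_hypBlockGL_of_mem L S _ hw]
    · rw [coe_endoBlock_eq_cayley_of_not_mem L S _ hw, coe_endoBlock_eq_cayley_of_not_mem L S _ hw]
  · apply (archPiEquivCM 1 L (Matrix.of fun i j : Fin 1 => if i.val + j.val + 1 = 1 then (1 : L) else 0)).injective
    rw [show (endoTorus L S c').2 = (archPiEquivCM 1 L (Matrix.of fun i j : Fin 1 => if i.val + j.val + 1 = 1 then (1 : L) else 0)).symm (endoCircle L c') from rfl, ContinuousMulEquiv.apply_symm_apply]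
    funext w
    apply Subtype.ext
    rw [(hc' w).2, coe_endoCircle_eq, coe_endoCircle_eq]

/-- **THE CENTRALISER OF AN `H`-REGULAR CHART POINT IS THE CHART TORUS**: `g ∈ Z_{H_∞}(endoTorus S c) ↔ ∃ c′, g = endoTorus S c′` (`c ∈ RegS S`) — the `chartTorusH S` of
PACK-SPEC §1 in either spelling (range of the chart hom; its closure is redundant). [cite: Rogawski1990, §3.1 p. 19; §3.6 p. 31] -/
theorem mem_centralizer_endoTorus_iff {c : {w : InfinitePlace L // IsComplex w} → Fin 3 → ℝ} (hc : c ∈ ArchCartan.RegS S)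
    (g : (↥(arch (↥(maximalRealSubfield L)) L (IsCMField.complexConj L) 2 (Matrix.of fun i j : Fin 2 => if i.val + j.val + 1 = 2 then (1 : L) else 0)) × ↥(arch (↥(maximalRealSubfield L)) L (IsCMField.complexConj L) 1 (Matrix.of fun i j : Fin 1 => if i.val + j.val + 1 = 1 then (1 : L) else 0)))) :
    g ∈ Subgroup.centralizer ({endoTorus L S c} : Set (↥(arch (↥(maximalRealSubfield L)) L (IsCMField.complexConj L) 2 (Matrix.of fun i j : Fin 2 => if i.val + j.val + 1 = 2 then (1 : L) else 0)) × ↥(arch (↥(maximalRealSubfield L)) L (IsCMField.complexConj L) 1 (Matrix.of fun i j : Fin 1 => if i.val + j.val + 1 = 1 then (1 : L) else 0)))) ↔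
      ∃ c' : {w : InfinitePlace L // IsComplex w} → Fin 3 → ℝ, g = endoTorus L S c' := by
  rw [Subgroup.mem_centralizer_singleton_iff]
  constructor
  · intro h
    exact exists_eq_endoTorus_of_commute L S hc g h
  · rintro ⟨c', rfl⟩
    exact endoTorus_mul_comm L S c' c

/-- The centralisers of any two `H`-regular chart points of the same chart coincide — ONE Haar measure on the chart torus serves every regular point.
[cite: Rogawski1990, §3.1 p. 19] -/
theorem centralizer_endoTorus_eq_centralizer {c₁ c₂ : {w : InfinitePlace L // IsComplex w} → Fin 3 → ℝ} (h₁ : c₁ ∈ ArchCartan.RegS S) (h₂ : c₂ ∈ ArchCartan.RegS S) :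
    Subgroup.centralizer ({endoTorus L S c₁} : Set (↥(arch (↥(maximalRealSubfield L)) L (IsCMField.complexConj L) 2 (Matrix.of fun i j : Fin 2 => if i.val + j.val + 1 = 2 then (1 : L) else 0)) × ↥(arch (↥(maximalRealSubfield L)) L (IsCMField.complexConj L) 1 (Matrix.of fun i j : Fin 1 => if i.val + j.val + 1 = 1 then (1 : L) else 0)))) =
      Subgroup.centralizer ({endoTorus L S c₂} : Set (↥(arch (↥(maximalRealSubfield L)) L (IsCMField.complexConj L) 2 (Matrix.of fun i j : Fin 2 => if i.val + j.val + 1 = 2 then (1 : L) else 0)) × ↥(arch (↥(maximalRealSubfield L)) L (IsCMField.complexConj L) 1 (Matrix.of fun i j : Fin 1 => if i.val + j.val + 1 = 1 then (1 : L) else 0)))) := by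
  ext g
  rw [mem_centralizer_endoTorus_iff L S h₁, mem_centralizer_endoTorus_iff L S h₂]

/-- Every chart point lies in the centraliser of every chart point. [cite: Rogawski1990, §3.6 p. 31] -/
theorem endoTorus_mem_centralizer (c c' : {w : InfinitePlace L // IsComplex w} → Fin 3 → ℝ) :
    endoTorus L S c' ∈ Subgroup.centralizer ({endoTorus L S c} : Set (↥(arch (↥(maximalRealSubfield L)) L (IsCMField.complexConj L) 2 (Matrix.of fun i j : Fin 2 => if i.val + j.val + 1 = 2 then (1 : L) else 0)) × ↥(arch (↥(maximalRealSubfield L)) L (IsCMField.complexConj L) 1 (Matrix.of fun i j : Fin 1 => if i.val + j.val + 1 = 1 then (1 : L) else 0)))) := by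
  rw [Subgroup.mem_centralizer_singleton_iff]
  exact endoTorus_mul_comm L S c' c

end Global

end Literature.NumberTheory.Automorphic.UnitaryGroup

end
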